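import Summits.QuantumFields.YangMills.Theses.PencilRigidity
import Summits.QuantumFields.YangMills.Theorems.HypercubicLimit.Negative.ExtendByZero

/-!
# `WeakCouplingHypercubicLimit` (crux stmt-QuantumFields-16120, route PencilRigidity) — negative side:
# any kill of the crux refutes the summit statement `YangMills` as typed

Support file extracted from the standing disprover's work file
`Cruxes/WeakCouplingHypercubicLimit/Disproof.lean` §1 (cycle 1).  The crux is the re-typed Clay
statement `YangMills` (2026-08-16: first conjunct `sch.HasWeakCouplingLimit`) minus the rotation half of
E1, in ONE-FIELD GAUGE.  `not_yangMills_of_not_weakCouplingHypercubicLimit` records, kernel-checked,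
that the one-field clause costs nothing and hence that **`¬ WeakCouplingHypercubicLimit → ¬ YangMills`**:
from a summit witness `(r, sch, T)` silence every species other than the curvature (the scheme
`{ sch with c := … if s = r.curvature then sch.c s k else 0 }` keeps `β`, so the weak-coupling clause,
and `(a, L)`, so `HasLatticeMassGap`) and replace `T.schwinger` by the extension by zero of its
curvature channel (`Negative/ExtendByZero`: every OS clause, the continuum gap, non-triviality and
non-Gaussianity survive; strings with a silenced species have vanishing lattice correlations, matching
the zero extension).  Consequence for the adversary: no unconditional `¬` of this crux is to be had from
junk — a disproof here is a disproof of `YangMills` in the tree's rendering; for provers: the crux is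
NECESSARY for the summit, so nothing is lost by routing through it. [folklore]

(The landed `Negative/OneFieldReduction.lean` of the sibling crux states the same reduction for the
β-free predecessor but names the dropped decl `PencilRigidity.HypercubicLimit`; this file does not use it.)
-/

noncomputable section

open scoped SchwartzMap
open MeasureTheory Filter Topology Complex
open Literature.MathematicalPhysics.AQFT Literature.MathematicalPhysics.QuantumLattice
open Literature.MathematicalPhysics.QuantumFieldTheory
open Summit.QuantumFields.YangMills.Theorems.HypercubicLimit.Negative

namespace Summit.QuantumFields.YangMills.Theorems.WeakCouplingHypercubicLimit.Negative

/-- **Any kill of `PencilRigidity.WeakCouplingHypercubicLimit` refutes `YangMills` as typed**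
(equivalently: the summit implies the crux — forget `SO(4)`, silence the non-curvature species, extend
the curvature channel by zero). [folklore] -/
theorem not_yangMills_of_not_weakCouplingHypercubicLimit
    (h : ¬ Summit.QuantumFields.YangMills.Theses.PencilRigidity.WeakCouplingHypercubicLimit) :
    ¬ YangMills := by
  intro hYM
  refine h fun G _ _ _ _ hG => ?_
  letI : MeasurableSpace G := borel G
  haveI : BorelSpace G := ⟨rfl⟩
  obtain ⟨r, sch, T, hweak, hconv, hnt, hng, Δ, hΔ, hgap, hlat⟩ := hYM G hG
  classical
  -- the scheme silencing every species but the curvature (same `a, β, L, m`)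
  let sch' : SpeciesScheme (YMSpecies G) :=
    { sch with c := fun s k => if s = r.curvature then sch.c s k else 0 }
  have hne : ∀ (k n : ℕ) (σ : Fin n → YMSpecies G) (f : Fin n → SchwartzMap (EuclideanSpace ℝ (Fin 4)) ℝ) (i₀ : Fin n),
      σ i₀ ≠ r.curvature → latticeSchwinger r.ρ sch' (fun s => s.F) k n σ f = 0 := by
    intro k n σ f i₀ hi₀
    unfold latticeSchwinger
    have h0 : sch'.c (σ i₀) k = 0 := by simp [sch', hi₀]
    have : ∀ U : GaugeConfig 4 (sch'.side k) G,
        ∏ i, smearedLatticeField ((fun s : YMSpecies G => s.F) (σ i))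
          (Literature.Probability.LatticeModels.box 4 (sch'.L k)) (sch'.a k) (sch'.c (σ i) k)
          (sch'.m (σ i) k) (f i) (torusLift (sch'.side k) U) = 0 := fun U =>
      Finset.prod_eq_zero (Finset.mem_univ i₀) (by rw [h0]; simp [smearedLatticeField])
    simp_rw [this, integral_zero]
  have hself : ∀ (k n : ℕ) (f : Fin n → SchwartzMap (EuclideanSpace ℝ (Fin 4)) ℝ),
      latticeSchwinger r.ρ sch' (fun s => s.F) k n (fun _ => r.curvature) f =
        latticeSchwinger r.ρ sch (fun s => s.F) k n (fun _ => r.curvature) f := by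
    intro k n f
    have hc : sch'.c r.curvature k = sch.c r.curvature k := by simp [sch']
    unfold latticeSchwinger
    simp_rw [hc]
    rfl
  have hos : (T.schwinger.IsNormalized ∧ T.schwinger.IsHermitian ∧ T.schwinger.HasLinearGrowth ∧ T.schwinger.IsReflectionPositive ∧ T.schwinger.IsSymmetric ∧ T.schwinger.HasClusterProperty ∧ (∀ (n : ℕ) (k : Fin n → YMSpecies G) (a : (EuclideanSpace ℝ (Fin 4))) (F : SchwartzMap (Fin n → (EuclideanSpace ℝ (Fin 4))) ℂ), IsOffDiagonal F → T.schwinger n k (translateMulti a F) = T.schwinger n k F) ∧ (∀ (n : ℕ) (k : Fin n → YMSpecies G) (R : (EuclideanSpace ℝ (Fin 4)) ≃ₗᵢ[ℝ] (EuclideanSpace ℝ (Fin 4))), LinearMap.det (R.toLinearEquiv : (EuclideanSpace ℝ (Fin 4)) →ₗ[ℝ] (EuclideanSpace ℝ (Fin 4))) = 1 → (∀ i : Fin 4, ∃ j : Fin 4, R (EuclideanSpace.single i 1) = EuclideanSpace.single j 1 ∨ R (EuclideanSpace.single i 1) = -EuclideanSpace.single j 1) → ∀ F : SchwartzMap (Fin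 n → (EuclideanSpace ℝ (Fin 4))) ℂ, IsOffDiagonal F → T.schwinger n k (linActMulti R F) = T.schwinger n k F)) :=
    ⟨T.normalized, T.hermitian, T.linearGrowth, T.reflectionPositive, T.symmetric, T.cluster,
      T.invariant.1, fun n k R hdet _ F hF => T.invariant.2 n k R hdet F hF⟩
  refine ⟨r, sch', extendByZero r.curvature (restrictTo r.curvature T.schwinger), hweak, ?_,
    osClauses_extendByZero (osClauses_restrictTo _ hos), ?_, ?_, ?_, Δ, hΔ,
    hasMassGap_extendByZero (hasMassGap_restrictTo _ hgap), hlat⟩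
  · -- one-field gauge
    rintro n k ⟨i, hi⟩ F
    rw [extendByZero_of_not_all _ _ (fun hall => hi (hall i))]
    rfl
  · -- convergence along the silenced scheme
    intro n hn σ f F hF hod
    by_cases hσ : ∀ i, σ i = r.curvature
    · obtain rfl : σ = fun _ => r.curvature := funext hσ
      rw [extendByZero_const]
      simp_rw [hself]
      exact hconv n hn _ f F hF hod
    · push Not at hσ
      obtain ⟨i₀, hi₀⟩ := hσ
      rw [extendByZero_of_not_all _ _ (fun hall => hi₀ (hall i₀))]
      simp_rw [hne _ n σ f i₀ hi₀]
      simp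
  · -- non-triviality of the curvature channel
    unfold OSData.IsNontrivial at hnt
    simpa [restrictTo] using hnt
  · -- non-Gaussianity of the curvature channel
    unfold OSData.IsNonGaussian at hng
    simpa [restrictTo] using hng

end Summit.QuantumFields.YangMills.Theorems.WeakCouplingHypercubicLimit.Negative

end
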